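import Literature.AlgebraicGeometry.HodgeTheory.AbelianVarietyHomTorsionScalarRigidityOneSided
import Literature.AlgebraicGeometry.Motives.AbelianVarietyFiniteKernelQuasiInverse
import Literature.AlgebraicGeometry.AbelianVarieties.AbelianVarietyWeilDivisorBundleDictionary
import HarnessLib

/-!
# Polarisation rigidity: two `Λ(𝒪(Θ))`-read homomorphisms with proportional Weil-pairing towers are equal
# ([MFK94] Def. 6.2–6.3; Lange 2023 Cor. 2.4.11 mechanism; Lang VII §2 Prop. 3–4)

Topic `AlgebraicGeometry/AbelianVarieties`; namespace `Literature.AlgebraicGeometry.AbelianVarieties`.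
KERNEL ONLY: one theorem (+ private helpers); no definition, no named fact, no instance, no `sorry`.

THE ASSEMBLED STATEMENT (`eq_of_slice_dictionary_of_weilPairingLevel_towers`).  Let `A, B` be complex abelian
varieties, `0 < dim A`, `lam₁, lam₂ : A → B` homomorphisms, `lam₁` with finite kernel, and `Θ₁, Θ₂` ample Cartier
divisors on `A` such that the values of `lam₂`, `lam₁` are READ by the `Λ(𝒪(Θ))`-slices of [MumfordFogartyKirwan1994,
Def. 6.2] — `lam₂(Q) = lam₁(Q′)` iff `t_Q^*𝒪(Θ₂) ⊗ 𝒪(Θ₂)⁻¹ ≅ t_{Q′}^*𝒪(Θ₁) ⊗ 𝒪(Θ₁)⁻¹` (the dictionary the tree's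
★ D2 `IsLambdaOfAt` + `DualPair.eq_of_nonempty_iso` provide for a polarisation and its dual-transported twin).
If the level Weil pairings of `Θ₂` and `Θ₁` are PROPORTIONAL BY UNITS along a cofinal tower `N ∣ M`
(`ē^{Θ₂}_M = (ē^{Θ₁}_M)^{a_M}`, `a_M` coprime to `M` — two symplectic-similitude level towers,
★ `exists_isCoprime_weilPairingLevel_pullback_eq_zpow`), then `lam₂ = lam₁`.

Proof (all inputs ★): pairings proportional ⇒ slices `(Θ₂, Q) ≅ (Θ₁, Q^{a_M})`
(`nonempty_translateTensorDual_iso_of_forall_weilPairingLevel_eq_zpow`, Lang VII §2 Prop. 4) ⇒ `lam₂(Q) = lam₁(Q^{a_M})`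
on `A[M](ℂ)` ⇒ `lam₂ = ±lam₁` by ONE-SIDED rigidity (`eq_or_eq_neg_of_forall_torsionPoints_map_eq_pow_of_comp_eq`, the
left quasi-inverse from `exists_comp_eq_zsmul_id_of_finite_kerPoints`); the sign `−` would read back through the
dictionary as `ē^{Θ₂}_M = (ē^{Θ₁}_M)⁻¹` (`weilPairingLevel_eq_of_nonempty_translateTensorDual_iso`,
`weilPairingLevel_inv_right`), excluded for ample `Θ₁, Θ₂` (`not_forall_weilPairingLevel_eq_inv_of_isAmple`).

Use (cell `hodgecm-mathlib`, W3c H3 λ-half (c-iii)): with `lam₁ := λ″` and `lam₂ := H⁻¹ ≫ λσ ≫ Ĥ` on the `𝟙`-fibre,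
the dictionary hypothesis is ★ (D-1) `valueAt_eq_iff_nonempty_iso_of_isLambdaOfAt` (+ the (c-ii-T) transport of
`IsLambdaOfAt`), the tower hypothesis is ★ (S1) fed by the marked isomorphism's `GSp_δ(ℤ/M)` transition, and the
conclusion is the λ-clause `λσ ≫ Ĥ = H ≫ λ″` of D4 `IsBaseChangeVia`.

## References
* [MumfordFogartyKirwan1994] GIT, Ch. 6 §2 Def. 6.2–6.3 (p. 120), Ch. 7 §2 Def. 7.3 (p. 130).
* [Lange2023AbelianVarietiesComplex] H. Lange, *Abelian Varieties over the Complex Numbers* (2023), §2.4.1 Cor. 2.4.11.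
* [Lang1983AbelianVarieties] S. Lang, *Abelian Varieties*, Ch. VII §2 Prop. 3 and Prop. 4.
-/

noncomputable section

namespace Literature.AlgebraicGeometry.AbelianVarieties

open CategoryTheory _root_.AlgebraicGeometry MonoidalCategory
open Literature.AlgebraicGeometry.Motives Literature.AlgebraicGeometry.Motives.AbelianVariety
open Literature.AlgebraicGeometry.Modules Literature.AlgebraicGeometry.HodgeTheory

variable {A B : Motives.AbelianVariety ℂ}

/-- `(u - v)(P) = u(P) · v(P)⁻¹` on complex points. [cite: MumfordAV1970, §19 (first paragraph)] -/
private theorem map_hom_sub' (u v : A ⟶ B) (P : A.Points ℂ) :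
    AlgPoints.map (u - v).hom.hom.hom P = AlgPoints.map u.hom.hom.hom P * (AlgPoints.map v.hom.hom.hom P)⁻¹ := by
  rw [eq_mul_inv_iff_mul_eq]
  have h : AlgPoints.map ((u - v) + v).hom.hom.hom P =
      AlgPoints.map (u - v).hom.hom.hom P * AlgPoints.map v.hom.hom.hom P := by
    rw [AlgPoints.map_apply, hom_add, Grp.Hom.hom_mul, Mon.Hom.hom_mul, MonObj.comp_mul]
    rfl
  rw [← h, sub_add_cancel]

/-- `(-v)(P) = v(P)⁻¹` on complex points. [cite: MumfordAV1970, §19 (first paragraph)] -/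
private theorem map_hom_neg' (v : A ⟶ B) (P : A.Points ℂ) :
    AlgPoints.map (-v).hom.hom.hom P = (AlgPoints.map v.hom.hom.hom P)⁻¹ := by
  have h := map_hom_sub' 0 v P
  rw [zero_sub] at h
  rw [h, AlgPoints.map_apply, hom_zero, Grp.Hom.hom_one, Mon.Hom.hom_one, MonObj.comp_one, one_mul]

/-- **POLARISATION RIGIDITY (assembled).**  Complex abelian varieties `A, B` with `0 < dim A`; homomorphisms
`lam₁, lam₂ : A → B`, `lam₁` with finite kernel; ample Cartier divisors `Θ₁, Θ₂` on `A` whose `Λ(𝒪(Θ))`-slices READ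
the values (`lam₂(Q) = lam₁(Q′) ↔ t_Q^*𝒪(Θ₂) ⊗ 𝒪(Θ₂)⁻¹ ≅ t_{Q′}^*𝒪(Θ₁) ⊗ 𝒪(Θ₁)⁻¹`); level Weil pairings proportional
by units along a cofinal tower `N ∣ M`.  Then `lam₂ = lam₁`.
[cite: MumfordFogartyKirwan1994, Ch. 6 §2 Definition 6.2–6.3 (p. 120)] [cite: Lange2023AbelianVarietiesComplex, §2.4.1 Cor. 2.4.11 (PDF p. 117)]
[cite: Lang1983AbelianVarieties, Ch. VII §2 Prop. 3 and Prop. 4] -/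
theorem eq_of_slice_dictionary_of_weilPairingLevel_towers (hA : 0 < A.dim) (lam₁ lam₂ : A ⟶ B)
    (hfin : {P : A.Points ℂ | AlgPoints.map lam₁.hom.hom.hom P = 1}.Finite)
    {Θ₁ Θ₂ : CartierDivisor A.X.left} (h₁ : Θ₁.IsAmple) (h₂ : Θ₂.IsAmple)
    (hdict : ∀ Q Q' : A.Points ℂ,
      AlgPoints.map lam₂.hom.hom.hom Q = AlgPoints.map lam₁.hom.hom.hom Q' ↔
        Nonempty (tensorObj ((Scheme.Modules.pullback (A.translation Q).left).obj (lineBundle Θ₂.toUnitCocycle))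
            (Modules.dual (lineBundle Θ₂.toUnitCocycle)) ≅
          tensorObj ((Scheme.Modules.pullback (A.translation Q').left).obj (lineBundle Θ₁.toUnitCocycle))
            (Modules.dual (lineBundle Θ₁.toUnitCocycle))))
    {N : ℕ} (hN : N ≠ 0)
    (htower : ∀ M : ℕ, N ∣ M → ∀ (hM : (M : ℂ) ≠ 0), ∃ a : ℤ, IsCoprime a (M : ℤ) ∧
      ∀ P Q : A.torsionPoints ℂ M,
        haveI := Motives.AbelianVariety.isDominant_toSchemeHom_zsmul_of_ne_zero A hM
        A.weilPairingLevel Θ₂ P Q = A.weilPairingLevel Θ₁ P Q ^ a) :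
    lam₂ = lam₁ := by
  classical
  -- Step 1: `lam₂(Q) = lam₁(Q^{a_M})` on `A[M](ℂ)`, through the dictionary
  have hpts : ∀ M : ℕ, N ∣ M → M ≠ 0 → ∃ a : ℤ, IsCoprime a (M : ℤ) ∧
      ∀ P ∈ A.torsionPoints ℂ M, AlgPoints.map lam₂.hom.hom.hom P = AlgPoints.map lam₁.hom.hom.hom P ^ a := by
    intro M hNM hM0
    have hMC : (M : ℂ) ≠ 0 := by exact_mod_cast hM0
    obtain ⟨a, ha, hPQ⟩ := htower M hNM hMC
    refine ⟨a, ha, fun P hP => ?_⟩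
    haveI := Motives.AbelianVariety.isDominant_toSchemeHom_zsmul_of_ne_zero A hMC
    have hiso := nonempty_translateTensorDual_iso_of_forall_weilPairingLevel_eq_zpow A hMC Θ₁ Θ₂ ⟨P, hP⟩ a
      (fun R => hPQ R ⟨P, hP⟩)
    rw [← map_hom_zpow]
    exact (hdict P (P ^ a)).2 hiso
  -- Step 2: one-sided rigidity with the left quasi-inverse of the finite-kernel `lam₁`
  obtain ⟨ψ, n, hn, hψ⟩ := exists_comp_eq_zsmul_id_of_finite_kerPoints lam₁ hfin
  rcases HodgeTheory.AbelianVariety.eq_or_eq_neg_of_forall_torsionPoints_map_eq_pow_of_comp_eq lam₁ lam₂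
      ⟨ψ, n, hn, hψ⟩ hN hpts with h | h
  · exact h
  · -- Step 3: the sign `−` would give inverse pairings, impossible for two ample divisors
    exfalso
    refine HodgeTheory.AbelianVariety.not_forall_weilPairingLevel_eq_inv_of_isAmple hA h₁ h₂ hN ?_
    intro M hNM hMC P Q
    haveI := Motives.AbelianVariety.isDominant_toSchemeHom_zsmul_of_ne_zero A hMC
    -- `lam₂(Q) = lam₁(Q)⁻¹ = lam₁(Q⁻¹)`, so the slices `(Θ₂, Q)` and `(Θ₁, Q⁻¹)` are isomorphic
    have hval : AlgPoints.map lam₂.hom.hom.hom (Q : A.Points ℂ) =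
        AlgPoints.map lam₁.hom.hom.hom ((Q : A.Points ℂ)⁻¹) := by
      rw [h, map_hom_neg', ← zpow_neg_one, ← map_hom_zpow, zpow_neg_one]
    have hsl := (hdict Q.1 (Q.1)⁻¹).1 hval
    have hQ' : ((Q⁻¹ : A.torsionPoints ℂ M) : A.Points ℂ) = (Q : A.Points ℂ)⁻¹ := rfl
    have key := weilPairingLevel_eq_of_nonempty_translateTensorDual_iso A (Θ₁ := Θ₁) (Θ₂ := Θ₂)
      (Q₁ := Q⁻¹) (Q₂ := Q) hsl P
    rw [key, weilPairingLevel_inv_right]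

end Literature.AlgebraicGeometry.AbelianVarieties

end
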